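import Summits.QuantumAdvantage.AdviceFreeQNC0.TensorBlocks
import Summits.QuantumAdvantage.AdviceFreeQNC0.DualDistanceCount
import Literature.Computability.MetaComplexity.SmolenskyCorrelationRestrict
import HarnessLib

/-!
# Cell qa-qnc0 (rung F-Q1, density axis, crux of record `TensorMultOneAt` = MULT₁): dual words of the
# `k`-block sum code — blockwise duality, the single-block weights, fibres and co-fibres

Planner qa-qnc0-p1 gen 13 (`HOME/qa-qnc0-p1/ROUND-12.md` §2, `Sketch13.lean` = `TensorBlocks.lean` in the
tree) reduces the density target `T10W` to TENSOR MULTIPLICATIVITY of the `k`-block SUM CODE at one block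
degree `t` (`SumCodeWin n k t`).  The LP / fractional-packing certificates for such coset weights use the
ODD DUAL WORDS of the sum code; literature seat qn-lit g12 (`HOME/qa-qnc0-lit/LIT-MEMO-19.md` §2, FENCE
L24-A) observed that they are tensor-product-code words and hence heavy, which caps every LP certificate at
the payoff threshold.  This file is the first half of the kernel form of that fence (the tensor induction and
the LP ceiling are in `SumCodeDualDistance.lean`), over the Sketch13 vocabulary (`blockIdx` / `mergeBlock` /
`blockWt` / `HasBlockDeg` / `IsBlockElim` / `SumCodeWin`):

* `IsBlockDual n k j t A` / `IsSumCodeDual n k t A` / `IsDualFor n k t J A` — `A ⊆ {0,1}ⁿ` meets every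
  block-`j` eliminator pattern / every sum-code pattern / every pattern of every block in `J` in an even
  number of points; `SumCodeDual.isBlockDual_of_isSumCodeDual`: sum-code duality ⇒ blockwise duality;
* SINGLE BLOCK, ANY block `j` of ANY cube (`SumCodeDual.two_pow_succ_le_card`,
  `SumCodeDual.three_mul_two_pow_le_card`): a nonempty block-`j`-dual set has `≥ 2^{t+1}` points, an odd
  one `≥ 3·2^t` — the even triples `(T,0,T)`, `(0,T,T)`, `(T,T,0)` with `T` the indicator of an arbitrary
  polynomial of degree `≤ t` (a block-degree-`t` function by `Smolensky.comp_subst_mem_lowDeg`) make the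
  three residue-class complements of `A` annihilate `lowDeg t`; the tree's dual-distance count
  (`two_pow_succ_le_card_of_sum_lowDeg_eq_zero`, `DualDistanceCount.lean`) weighs them, and they cover `A`
  twice.  Block form of `oddDualWord_card_ge` (`OddDualWords.lean`, prover seat qa-qnc0-prover-2, whose
  single block is the whole cube);
* FIBRES (`SumCodeDual.offPart` / `onPart`, `isBlockDual_filter`, `isBlockDual_fibre`): cutting a
  block-`j`-dual set by a test that ignores the block-`j` bits keeps it block-`j`-dual.

WHAT THIS IS NOT: nothing on `TensorMultOneAt` / MULT₁ (OPEN) or on crux α; separation NOT moved.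
-/

namespace Summit.QuantumAdvantage.AdviceFreeQNC0

open Finset
open Literature.Computability.MetaComplexity Literature.Computability.MetaComplexity.Smolensky

variable {n : ℕ}

/-- `A ⊆ {0,1}ⁿ` is DUAL TO BLOCK `j` (at block degree `t`, blocks of `Sketch13.blockIdx n k`): it meets
every block-`j` eliminator pattern in an even number of points. -/
def IsBlockDual (n k j t : ℕ) (A : Finset (Fin n → Bool)) : Prop :=
  ∀ X : (Fin n → Bool) → Bool, IsBlockElim n k j t X → (A.filter fun u => X u = true).card % 2 = 0

/-- `A ⊆ {0,1}ⁿ` is a DUAL WORD OF THE `k`-BLOCK SUM CODE at block degree `t`: it meets every pattern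
`win ∈ SumCodeWin n k t` in an even number of points. -/
def IsSumCodeDual (n k t : ℕ) (A : Finset (Fin n → Bool)) : Prop :=
  ∀ win : (Fin n → Bool) → Bool, SumCodeWin n k t win → (A.filter fun u => win u = true).card % 2 = 0

/-- `A` is dual to every block in the finite set `J`. -/
def IsDualFor (n k t : ℕ) (J : Finset ℕ) (A : Finset (Fin n → Bool)) : Prop :=
  ∀ j ∈ J, IsBlockDual n k j t A

namespace SumCodeDual

/-! ### From sum-code duality to blockwise duality -/

/-- The all-`false` pattern is a block-`j` eliminator pattern (triple `(0,0,0)`). -/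
theorem isBlockElim_false (n k j t : ℕ) : IsBlockElim n k j t (fun _ : Fin n → Bool => false) :=
  ⟨fun _ _ => false, fun _ _ => hasDeg_false t, fun _ => by simp, fun _ => rfl⟩

/-- A dual word of the sum code is dual to each block `j < k` (test the sum-code pattern with the
given block-`j` pattern in slot `j` and `false` elsewhere). -/
theorem isBlockDual_of_isSumCodeDual {k t : ℕ} {A : Finset (Fin n → Bool)}
    (hA : IsSumCodeDual n k t A) {j : ℕ} (hj : j < k) : IsBlockDual n k j t A := by
  classical
  intro X hX
  let Xs : ℕ → (Fin n → Bool) → Bool := fun j' => if j' = j then X else fun _ => false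
  have hXs : ∀ j', IsBlockElim n k j' t (Xs j') := by
    intro j'
    by_cases h : j' = j
    · simp only [Xs, h, if_true]; exact hX
    · simp only [Xs, h, if_false]; exact isBlockElim_false n k j' t
  have hwin : SumCodeWin n k t X := by
    refine ⟨Xs, fun j' _ => hXs j', fun u => ?_⟩
    by_cases hx : X u = true
    · have hS : ((range k).filter fun j' => Xs j' u = true) = {j} := by
        ext j'
        simp only [mem_filter, mem_range, mem_singleton, Xs]
        constructor
        · rintro ⟨_, h2⟩
          by_contra hne
          rw [if_neg hne] at h2
          exact Bool.false_ne_true h2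
        · intro h2
          rw [h2, if_pos rfl]
          exact ⟨hj, hx⟩
      rw [hS, hx, card_singleton]
      decide
    · have hS : ((range k).filter fun j' => Xs j' u = true) = ∅ := by
        refine filter_eq_empty_iff.2 fun j' _ => ?_
        simp only [Xs]
        split_ifs with h
        · exact hx
        · simp
      rw [hS, card_empty, Bool.eq_false_iff.2 hx]
      decide
  exact hA X hwin

/-- Sum-code duality gives duality for the block set `range k`. -/
theorem isDualFor_range {k t : ℕ} {A : Finset (Fin n → Bool)} (hA : IsSumCodeDual n k t A) :
    IsDualFor n k t (range k) A :=
  fun _ hj => isBlockDual_of_isSumCodeDual hA (mem_range.1 hj)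

/-! ### Single block: polynomial indicators are block-degree-`t` functions, masked triples are patterns -/

/-- The Boolean indicator of a `ZMod 2`-valued function. -/
def indZ (g : CubeFn (ZMod 2) n) : (Fin n → Bool) → Bool := fun u => decide (g u = 1)

/-- The `ZMod 2`-valued indicator of `indZ g` is `g` itself. -/
theorem ite_indZ (g : CubeFn (ZMod 2) n) (u : Fin n → Bool) :
    (if indZ g u = true then (1 : ZMod 2) else 0) = g u := by
  unfold indZ
  generalize g u = x
  fin_cases x <;> rfl

/-- The indicator of a polynomial of degree `≤ t` has block degree `≤ t` in EVERY block (substituting the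
off-block bits keeps the degree: `Smolensky.comp_subst_mem_lowDeg`). -/
theorem hasBlockDeg_indZ {k j t : ℕ} {g : CubeFn (ZMod 2) n} (hg : g ∈ lowDeg (ZMod 2) n t) :
    HasBlockDeg n k j t (indZ g) := by
  intro v
  unfold HasDeg
  have hfun : (fun x => if indZ g (mergeBlock n k j v x) = true then (1 : ZMod 2) else 0) =
      fun x => g (mergeBlock n k j v x) := by
    funext x; exact ite_indZ g _
  rw [hfun]
  refine comp_subst_mem_lowDeg (mergeBlock n k j v) (fun i => ?_) hg
  by_cases h : blockIdx n k i = j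
  · exact Or.inr ⟨i, fun x => by simp [mergeBlock, h]⟩
  · exact Or.inl ⟨v i, fun x => by simp [mergeBlock, h]⟩

/-- Masking a block-degree-`t` function `T` OFF one residue class `r₀` of the block weight gives a
block eliminator pattern (the even triple with `0` in slot `r₀` and `T` in the two other slots). -/
theorem isBlockElim_mask {k j t : ℕ} {T : (Fin n → Bool) → Bool} (hT : HasBlockDeg n k j t T)
    {r₀ : ℕ} (hr : r₀ < 3) :
    IsBlockElim n k j t (fun u => (!decide (blockWt n k j u % 3 = r₀)) && T u) := by
  refine ⟨fun r => if r = r₀ then (fun _ => false) else T, fun r => ?_, fun u => ?_, fun u => ?_⟩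
  · by_cases h : r = r₀
    · simp only [h, if_true]; intro v; exact hasDeg_false t
    · simp only [h, if_false]; exact hT
  · interval_cases r₀ <;> simp
  · by_cases h : blockWt n k j u % 3 = r₀
    · simp [h]
    · simp [h]

/-- Each residue-class complement of a block-dual set annihilates `lowDeg t`. -/
theorem sum_filter_ne_eq_zero {k j t : ℕ} {A : Finset (Fin n → Bool)} (hA : IsBlockDual n k j t A)
    {r₀ : ℕ} (hr : r₀ < 3) (g : CubeFn (ZMod 2) n) (hg : g ∈ lowDeg (ZMod 2) n t) :
    ∑ u ∈ A.filter (fun u => blockWt n k j u % 3 ≠ r₀), g u = 0 := by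
  have h := hA _ (isBlockElim_mask (hasBlockDeg_indZ (k := k) (j := j) hg) hr)
  have hset : (A.filter fun u => ((!decide (blockWt n k j u % 3 = r₀)) && indZ g u) = true) =
      (A.filter (fun u => blockWt n k j u % 3 ≠ r₀)).filter fun u => g u = 1 := by
    ext u
    simp only [mem_filter, indZ, Bool.and_eq_true, Bool.not_eq_true', decide_eq_false_iff_not,
      decide_eq_true_eq, and_assoc]
  have hcard := congrArg Finset.card hset
  have hsum : ∀ S : Finset (Fin n → Bool),
      ∑ u ∈ S, g u = ((S.filter fun u => g u = 1).card : ZMod 2) := by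
    intro S
    rw [Finset.card_filter, Nat.cast_sum]
    refine Finset.sum_congr rfl fun u _ => ?_
    generalize g u = x
    fin_cases x <;> rfl
  rw [hsum, ← hcard]
  exact (ZMod.natCast_eq_zero_iff_even).2 (Nat.even_iff.2 h)

/-- **Single block, any block of any cube:** a nonempty block-`j`-dual set has `≥ 2^{t+1}` points. -/
theorem two_pow_succ_le_card {k j t : ℕ} {A : Finset (Fin n → Bool)} (hA : IsBlockDual n k j t A)
    (hne : A.Nonempty) : 2 ^ (t + 1) ≤ A.card := by
  classical
  obtain ⟨u₀, hu₀⟩ := hne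
  -- a residue `r₀` different from that of `u₀`
  obtain ⟨r₀, hr₀, hne⟩ : ∃ r₀, r₀ < 3 ∧ blockWt n k j u₀ % 3 ≠ r₀ := by
    by_cases h : blockWt n k j u₀ % 3 = 0
    · exact ⟨1, by norm_num, by omega⟩
    · exact ⟨0, by norm_num, h⟩
  have hS : (A.filter fun u => blockWt n k j u % 3 ≠ r₀).Nonempty := ⟨u₀, mem_filter.2 ⟨hu₀, hne⟩⟩
  exact (two_pow_succ_le_card_of_sum_lowDeg_eq_zero t _ hS
    (fun g hg => sum_filter_ne_eq_zero hA hr₀ g hg)).trans (card_filter_le _ _)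

/-- Each residue-class complement of an ODD block-dual set is nonempty. -/
theorem filter_ne_nonempty {k j t : ℕ} {A : Finset (Fin n → Bool)} (hA : IsBlockDual n k j t A)
    (hodd : A.card % 2 = 1) {r₀ : ℕ} (hr : r₀ < 3) :
    (A.filter fun u => blockWt n k j u % 3 ≠ r₀).Nonempty := by
  classical
  rw [Finset.nonempty_iff_ne_empty]
  intro hempty
  obtain ⟨r', hr', hrr'⟩ : ∃ r', r' < 3 ∧ r' ≠ r₀ := by
    rcases Nat.eq_zero_or_pos r₀ with h | h
    · exact ⟨1, by norm_num, by omega⟩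
    · exact ⟨0, by norm_num, by omega⟩
  have hall : (A.filter fun u => blockWt n k j u % 3 ≠ r') = A := by
    refine Finset.filter_true_of_mem fun u hu => ?_
    have : ¬ (blockWt n k j u % 3 ≠ r₀) := by
      intro hne'
      have : u ∈ A.filter (fun u => blockWt n k j u % 3 ≠ r₀) := Finset.mem_filter.2 ⟨hu, hne'⟩
      rw [hempty] at this
      exact Finset.notMem_empty u this
    omega
  have h1 := sum_filter_ne_eq_zero hA hr' 1 (by rw [← mono_empty]; exact mono_mem_lowDeg (by simp))
  rw [hall] at h1
  simp only [Pi.one_apply, sum_const, nsmul_eq_mul, mul_one] at h1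
  have hev := (ZMod.natCast_eq_zero_iff_even).1 h1
  rw [Nat.even_iff] at hev
  omega

/-- `Σ_{r<3} |A ∖ A_r| = 2|A|` for the residue classes of the block-`j` weight. -/
theorem sum_card_filter_ne (k j : ℕ) (A : Finset (Fin n → Bool)) :
    (A.filter fun u => blockWt n k j u % 3 ≠ 0).card + (A.filter fun u => blockWt n k j u % 3 ≠ 1).card +
      (A.filter fun u => blockWt n k j u % 3 ≠ 2).card = 2 * A.card := by
  classical
  simp only [ne_eq]
  have h0 := Finset.card_filter_add_card_filter_not (s := A) (fun u => blockWt n k j u % 3 = 0)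
  have h1 := Finset.card_filter_add_card_filter_not (s := A) (fun u => blockWt n k j u % 3 = 1)
  have h2 := Finset.card_filter_add_card_filter_not (s := A) (fun u => blockWt n k j u % 3 = 2)
  have hpart : (A.filter fun u => blockWt n k j u % 3 = 0).card +
      (A.filter fun u => blockWt n k j u % 3 = 1).card +
      (A.filter fun u => blockWt n k j u % 3 = 2).card = A.card := by
    have h := (Finset.card_eq_sum_card_fiberwise (s := A) (t := range 3)
      (f := fun u => blockWt n k j u % 3)
      (fun u _ => by
        simp only [Finset.coe_range, Set.mem_Iio]
        exact Nat.mod_lt _ (by norm_num))).symm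
    simp only [Finset.sum_range_succ, Finset.sum_range_zero, zero_add] at h
    exact h
  omega

/-- **Single block, odd:** an odd block-`j`-dual set has `≥ 3·2^t` points (the three residue-class
complements are nonempty annihilators of `lowDeg t` and cover `A` twice; cf. `oddDualWord_card_ge`). -/
theorem three_mul_two_pow_le_card {k j t : ℕ} {A : Finset (Fin n → Bool)} (hA : IsBlockDual n k j t A)
    (hodd : A.card % 2 = 1) : 3 * 2 ^ t ≤ A.card := by
  have h0 := two_pow_succ_le_card_of_sum_lowDeg_eq_zero t _ (filter_ne_nonempty hA hodd (r₀ := 0) (by norm_num))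
    (fun g hg => sum_filter_ne_eq_zero hA (by norm_num) g hg)
  have h1 := two_pow_succ_le_card_of_sum_lowDeg_eq_zero t _ (filter_ne_nonempty hA hodd (r₀ := 1) (by norm_num))
    (fun g hg => sum_filter_ne_eq_zero hA (by norm_num) g hg)
  have h2 := two_pow_succ_le_card_of_sum_lowDeg_eq_zero t _ (filter_ne_nonempty hA hodd (r₀ := 2) (by norm_num))
    (fun g hg => sum_filter_ne_eq_zero hA (by norm_num) g hg)
  have hsum := sum_card_filter_ne k j A
  have : 2 ^ (t + 1) = 2 * 2 ^ t := by ring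
  omega

/-! ### Fibres and co-fibres of a block -/

/-- The OFF-block-`j` part of `u` (block `j` zeroed). -/
def offPart (n k j : ℕ) (u : Fin n → Bool) : Fin n → Bool := mergeBlock n k j u (fun _ => false)

/-- The block-`j` part of `u` (everything else zeroed). -/
def onPart (n k j : ℕ) (u : Fin n → Bool) : Fin n → Bool := mergeBlock n k j (fun _ => false) u

/-- Merging block-`j` bits into `v` does not change its off-block part. -/
theorem offPart_mergeBlock (k j : ℕ) (v w : Fin n → Bool) :
    offPart n k j (mergeBlock n k j v w) = offPart n k j v := by
  funext i
  unfold offPart mergeBlock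
  by_cases h : blockIdx n k i = j <;> simp [h]

/-- Merging block-`j'` bits into `v` does not change its block-`j` part (`j ≠ j'`). -/
theorem onPart_mergeBlock_ne {k j j' : ℕ} (hjj : j ≠ j') (v w : Fin n → Bool) :
    onPart n k j (mergeBlock n k j' v w) = onPart n k j v := by
  funext i
  simp only [onPart, mergeBlock]
  by_cases h : blockIdx n k i = j
  · have h' : ¬ blockIdx n k i = j' := fun h'' => hjj (h.symm.trans h'')
    rw [if_pos h, if_pos h, if_neg h']
  · rw [if_neg h, if_neg h]

/-- A vector is determined by its off-block and on-block parts. -/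
theorem eq_of_parts_eq {k j : ℕ} {u u' : Fin n → Bool} (hoff : offPart n k j u = offPart n k j u')
    (hon : onPart n k j u = onPart n k j u') : u = u' := by
  funext i
  by_cases h : blockIdx n k i = j
  · have := congrFun hon i
    unfold onPart mergeBlock at this
    simpa [h] using this
  · have := congrFun hoff i
    unfold offPart mergeBlock at this
    simpa [h] using this

/-- **Restriction lemma.** Cutting a block-`j`-dual set by a Boolean test that ignores the block-`j`
bits keeps it block-`j`-dual (the masked triple is again an even triple of block degree `≤ t`). -/
theorem isBlockDual_filter {k j t : ℕ} {A : Finset (Fin n → Bool)} (hA : IsBlockDual n k j t A)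
    (φ : (Fin n → Bool) → Bool) (hφ : ∀ v w, φ (mergeBlock n k j v w) = φ v) :
    IsBlockDual n k j t (A.filter fun u => φ u = true) := by
  classical
  rintro X ⟨T, hT, hxor, hX⟩
  have helim : IsBlockElim n k j t (fun u => φ u && X u) := by
    refine ⟨fun r u => φ u && T r u, fun r v => ?_, fun u => ?_, fun u => ?_⟩
    · have hrew : (fun w => φ (mergeBlock n k j v w) && T r (mergeBlock n k j v w)) =
          fun w => φ v && T r (mergeBlock n k j v w) := by
        funext w; rw [hφ]
      show HasDeg (fun w => φ (mergeBlock n k j v w) && T r (mergeBlock n k j v w)) t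
      rw [hrew]
      cases φ v
      · simp only [Bool.false_and]; exact hasDeg_false t
      · simp only [Bool.true_and]; exact hT r v
    · have h := hxor u
      show xor (φ u && T 0 u) (xor (φ u && T 1 u) (φ u && T 2 u)) = false
      cases φ u
      · simp
      · simpa using h
    · show (φ u && X u) = (φ u && T (blockWt n k j u % 3) u)
      rw [hX u]
  have h := hA _ helim
  have hset : (A.filter fun u => (φ u && X u) = true) =
      (A.filter fun u => φ u = true).filter fun u => X u = true := by
    ext u
    simp only [mem_filter, Bool.and_eq_true, and_assoc]
  rw [hset] at h
  exact h

/-- The fibre of `A` through `u₀` along block `j` (the points of `A` agreeing with `u₀` off block `j`)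
is block-`j`-dual. -/
theorem isBlockDual_fibre {k j t : ℕ} {A : Finset (Fin n → Bool)} (hA : IsBlockDual n k j t A)
    (u₀ : Fin n → Bool) :
    IsBlockDual n k j t (A.filter fun u => offPart n k j u = offPart n k j u₀) := by
  classical
  have h := isBlockDual_filter hA (fun u => decide (offPart n k j u = offPart n k j u₀))
    (fun v w => by simp only [offPart_mergeBlock])
  have hset : (A.filter fun u => decide (offPart n k j u = offPart n k j u₀) = true) =
      A.filter fun u => offPart n k j u = offPart n k j u₀ := by
    ext u; simp only [mem_filter, decide_eq_true_eq]
  rw [hset] at h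
  exact h

end SumCodeDual

end Summit.QuantumAdvantage.AdviceFreeQNC0
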